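import Literature.Geometry.Riemannian.GaussianLemma
import Literature.Geometry.Riemannian.HeatKernelHCenterLowerPoint
import HarnessLib

/-!
# Bamler's Gaussian lemma (Bamler 2020a, Lemma 7.x = arXiv v1 Lemma 28): the two conclusions

R. Bamler, *Entropy and heat kernel bounds on a Ricci flow background*, arXiv:2008.07093 (2020a),
§7.3, Lemma 28 (arXiv v1 numbering): for `m ≥ 3`, `Λ ≥ 0`, `ε, Q > 0` there is
`Z̲(m, Λ, ε, Q)` such that, for a Ricci flow of a smooth family of Riemannian metrics on a closed
connected `m`-manifold, times `a < s < t < T` with `R ≥ R_min` on `M × [s,t]`,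
`−R_min (t − s) ≤ Λ`, and `Z ≥ Z̲`: IF the Gaussian bound with constants `(Q, 2Z)` holds at all
`(x', t')`, `t' ∈ (s, (s+t)/2]`, at `H_m`-centres `(z', s)` (hypothesis (7.14)), THEN at time `t`

* (7.15) `K(x,t;y,s) ≤ Z (t−s)^{-m/2} e^{−𝒩*_s(x,t)} exp(−d_s(z,y)²/((8+ε)(t−s)))` for every
  `H_m`-centre `(z, s)` of `(x, t)` (`gaussianLemma`, first conjunct), and
* (7.16) `K(x,t;y₁,s) K(x,t;y₂,s) ≤ Z (t−s)^{-m} e^{−2𝒩*_s(x,t)} exp(−d_s(y₁,y₂)²/((8+ε)(t−s)))`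
  (second conjunct).

Both follow from the `α`-claim (7.17) `gaussianLemma_alpha` (`GaussianLemma.lean`): (7.16) with
`α ≤ 1` and `8 + ε/2 ≤ 8 + ε`; (7.15) by pairing `y₁ = y` with the point `y₂` near the
`H_m`-centre where `K(x,t;y₂,s) ≥ c τ^{-m/2} e^{−𝒩*}` (`exists_near_hCenter_le_heatKernelFn`,
Props. 3.13 and 5.?? of the source) and absorbing the shift `d_s(z,y) ≤ d_s(y,y₂) + √(2H_m(t−s))`
into the constant (`exp_neg_sq_div_le_exp_mul_exp_neg_sq_div`). The source works at scale
`s = 0, t = 1`; here everything is at general scale.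

## References

* R. H. Bamler, *Entropy and heat kernel bounds on a Ricci flow background*, arXiv:2008.07093
  (2020), §7.3, Lemma 7.x (arXiv v1 Lemma 28), (7.14)–(7.17). [Bamler2020Entropy]
-/

noncomputable section

open Set Filter Function MeasureTheory Measure
open scoped Manifold ContDiff Topology ENNReal NNReal

namespace Literature.Geometry.Riemannian

open Lorentzian Lorentzian.PseudoRiemannianMetric MetricFlow

/-! ### The elementary shift estimate -/

/-- **Absorbing a bounded shift into a Gaussian**: if `0 ≤ u ≤ A + w` with `A² = 2Hτ`, `τ > 0`, then
`exp(−w²/((8+ε/2)τ)) ≤ e^{C} exp(−u²/((8+ε)τ))` with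
`C = max(H/4, 4H(8+ε)/((8+ε/2)ε))` (case `u ≤ A`: `u²/((8+ε)τ) ≤ 2H/(8+ε) ≤ H/4`; case
`u > A`: `(u−A)² ≤ w²` and `u²/(8+ε) − (u−A)²/(8+ε/2) ≤ 4H(8+ε)τ/((8+ε/2)ε)` by completing the
square). This is the last display of the proof of (7.15) in the source.
[cite: Bamler2020Entropy, §7.3, proof of Lemma 7.x, display after (7.17)] -/
theorem exp_neg_sq_div_le_exp_mul_exp_neg_sq_div {H ε τ u w A : ℝ} (hε : 0 < ε)
    (hτ : 0 < τ) (hu : 0 ≤ u) (hA2 : A ^ 2 = 2 * H * τ) (huAw : u ≤ A + w) :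
    Real.exp (-w ^ 2 / ((8 + ε / 2) * τ)) ≤
      Real.exp (max (H / 4) (4 * H * (8 + ε) / ((8 + ε / 2) * ε))) *
        Real.exp (-u ^ 2 / ((8 + ε) * τ)) := by
  set C : ℝ := max (H / 4) (4 * H * (8 + ε) / ((8 + ε / 2) * ε)) with hC
  rw [← Real.exp_add, Real.exp_le_exp]
  have h8 : 0 < 8 + ε / 2 := by linarith
  have h8' : 0 < 8 + ε := by linarith
  rcases le_or_gt u A with huA | huA
  · -- `u ≤ A`: the left side is `≤ 0`, the right side is `≥ 0`
    have h1 : -w ^ 2 / ((8 + ε / 2) * τ) ≤ 0 := by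
      rw [neg_div]; exact neg_nonpos.2 (div_nonneg (sq_nonneg _) (by positivity))
    have h2 : u ^ 2 / ((8 + ε) * τ) ≤ H / 4 := by
      rw [div_le_div_iff₀ (by positivity) (by norm_num)]
      have hu2 : u ^ 2 ≤ A ^ 2 := pow_le_pow_left₀ hu huA 2
      nlinarith [hu2, hA2, hτ, hε, sq_nonneg A]
    have h3 : H / 4 ≤ C := le_max_left _ _
    have hY : -u ^ 2 / ((8 + ε) * τ) = -(u ^ 2 / ((8 + ε) * τ)) := neg_div _ _
    linarith
  · -- `u > A`: complete the square
    have hwA : u - A ≤ w := by linarith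
    have hsq : (u - A) ^ 2 ≤ w ^ 2 := pow_le_pow_left₀ (by linarith) hwA 2
    have h1 : -w ^ 2 / ((8 + ε / 2) * τ) ≤ -(u - A) ^ 2 / ((8 + ε / 2) * τ) := by
      rw [neg_div, neg_div, neg_le_neg_iff]
      exact div_le_div_of_nonneg_right hsq (by positivity)
    refine h1.trans ?_
    -- `−(u−A)²/((8+ε/2)τ) + u²/((8+ε)τ) ≤ C`
    have hδ : 0 < 1 / ((8 + ε / 2) * τ) - 1 / ((8 + ε) * τ) := by
      rw [sub_pos, one_div_lt_one_div (by positivity) (by positivity)]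
      nlinarith
    have key : -(u - A) ^ 2 / ((8 + ε / 2) * τ) + u ^ 2 / ((8 + ε) * τ) =
        -(1 / ((8 + ε / 2) * τ) - 1 / ((8 + ε) * τ)) * u ^ 2 +
          (2 * A / ((8 + ε / 2) * τ)) * u - A ^ 2 / ((8 + ε / 2) * τ) := by
      field_simp
      ring
    have hq := neg_mul_sq_add_mul_le (b := 2 * A / ((8 + ε / 2) * τ)) (u := u) hδ
    have hA2τ : A ^ 2 / ((8 + ε / 2) * τ) ≥ 0 := by positivity
    have hval : (2 * A / ((8 + ε / 2) * τ)) ^ 2 /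
        (4 * (1 / ((8 + ε / 2) * τ) - 1 / ((8 + ε) * τ))) =
        4 * H * (8 + ε) / ((8 + ε / 2) * ε) := by
      have hε0 : ε ≠ 0 := hε.ne'
      have hτ0 : τ ≠ 0 := hτ.ne'
      have h8ne : (8 + ε / 2) ≠ 0 := h8.ne'
      have h8ne' : (8 + ε) ≠ 0 := h8'.ne'
      have hδeq : 1 / ((8 + ε / 2) * τ) - 1 / ((8 + ε) * τ) =
          ε / (2 * ((8 + ε / 2) * ((8 + ε) * τ))) := by
        field_simp
        ring
      rw [hδeq, div_pow, mul_pow, hA2]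
      field_simp
      ring
    have h3 : 4 * H * (8 + ε) / ((8 + ε / 2) * ε) ≤ C := le_max_right _ _
    have hY : -u ^ 2 / ((8 + ε) * τ) = -(u ^ 2 / ((8 + ε) * τ)) := neg_div _ _
    linarith [key, hq, hval.le, hval.ge, h3, hA2τ, hY]

/-! ### Lemma 7.x: both conclusions -/

section Kernel

set_option maxHeartbeats 800000 in
/-- **Bamler 2020a, Lemma 7.x (arXiv v1 Lemma 28), conclusions (7.15) and (7.16).** For `m ≥ 3`,
`Λ ≥ 0` and `ε, Q > 0` there is `Z̲ > 0` such that for every Ricci flow on `[a,T]` of a smooth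
family of Riemannian metrics on a closed connected manifold modelled on `ℝᵐ`, all
`a < s < t < T` with `R ≥ R_min` on `M × [s,t]`, `−R_min(t−s) ≤ Λ`, and every `Z ≥ Z̲`: if the
Gaussian bound with constants `(Q, 2Z)` holds at all times `t' ∈ (s, (s+t)/2]` at `H_m`-centres
(hypothesis (7.14)), then
(i) `K(x,t;y,s) ≤ Z (t−s)^{-m/2} e^{−𝒩*_s(x,t)} exp(−d_s(z,y)²/((8+ε)(t−s)))` for every
`H_m`-centre `(z,s)` of `(x,t)` (kernel form `∫ d_s(z,·)² dν_{x,t;s} ≤ H_m (t−s)`), and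
(ii) `K(x,t;y₁,s) K(x,t;y₂,s) ≤ Z (t−s)^{-m} e^{−2𝒩*_s(x,t)} exp(−d_s(y₁,y₂)²/((8+ε)(t−s)))`.
Proof: the `α`-claim `gaussianLemma_alpha` with `α = min(1, c₀ e^{−C})`, where
`c₀ τ^{-m/2} e^{−𝒩*} ≤ K(x,t;y₂,s)` at a point `y₂` with `d_s(z,y₂) < √(2H_m(t−s))`
(`exists_near_hCenter_le_heatKernelFn`) and `C` is the shift constant of
`exp_neg_sq_div_le_exp_mul_exp_neg_sq_div`.
[cite: Bamler2020Entropy, §7.3, Lemma 7.x (arXiv v1 Lemma 28), (7.14)–(7.17)] -/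
theorem gaussianLemma (m : ℕ) (hm : 3 ≤ m) {Λ ε Q : ℝ} (hΛ : 0 ≤ Λ) (hε : 0 < ε) (hQ : 0 < Q) :
    ∃ Zbar : ℝ, 0 < Zbar ∧ ∀ {M : Type*} [TopologicalSpace M]
      [ChartedSpace (EuclideanSpace ℝ (Fin m)) M]
      [IsManifold 𝓘(ℝ, EuclideanSpace ℝ (Fin m)) ∞ M] [T2Space M] [CompactSpace M]
      [SecondCountableTopology M] [MeasurableSpace M] [BorelSpace M] [ConnectedSpace M] [T3Space M]
      {h : ℝ → PseudoRiemannianMetric 𝓘(ℝ, EuclideanSpace ℝ (Fin m)) ∞ (EuclideanSpace ℝ (Fin m))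
        (TangentSpace 𝓘(ℝ, EuclideanSpace ℝ (Fin m)) : M → Type _)}
      {cov : ℝ → CovariantDerivative 𝓘(ℝ, EuclideanSpace ℝ (Fin m)) (EuclideanSpace ℝ (Fin m))
        (TangentSpace 𝓘(ℝ, EuclideanSpace ℝ (Fin m)) : M → Type _)}
      {a T : ℝ} (hflow : IsRicciFlow h cov (Icc a T)) (hh : IsContMDiffFamilyOn ∞ h univ)
      (hR : ∀ r, (h r).IsRiemannian),
      ∀ {s t : ℝ}, a < s → s < t → t < T → ∀ {Rmin : ℝ},
      (∀ r ∈ Icc s t, ∀ z : M, Rmin ≤ (h r).scalarCurvatureWith (cov r) z) →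
      -Rmin * (t - s) ≤ Λ → ∀ {Z : ℝ}, Zbar ≤ Z →
      (∀ t' ∈ Ioc s ((s + t) / 2), ∀ x' y' z' : M,
        ∫⁻ w, (h s).edist (hR s) z' w ^ 2 ∂(heatKernelMeasure hh hR t' x' s) ≤
          ENNReal.ofReal ((((m : ℝ) - 1) * Real.pi ^ 2 / 2 + 4) * (t' - s)) →
        hflow.heatKernelFn hh hR t' x' (y', s) ≤
          2 * Z * (t' - s) ^ (-(m : ℝ) / 2) *
            Real.exp (-(pointedNashEntropy h (fun r v ↦ hflow.heatKernelFn hh hR t' x' (v, r)) m t' s)) *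
            Real.exp (-((h s).edist (hR s) z' y').toReal ^ 2 / (Q * (t' - s)))) →
      (∀ x y z : M,
        ∫⁻ w, (h s).edist (hR s) z w ^ 2 ∂(heatKernelMeasure hh hR t x s) ≤
          ENNReal.ofReal ((((m : ℝ) - 1) * Real.pi ^ 2 / 2 + 4) * (t - s)) →
        hflow.heatKernelFn hh hR t x (y, s) ≤
          Z * (t - s) ^ (-(m : ℝ) / 2) *
            Real.exp (-(pointedNashEntropy h (fun r v ↦ hflow.heatKernelFn hh hR t x (v, r)) m t s)) *
            Real.exp (-((h s).edist (hR s) z y).toReal ^ 2 / ((8 + ε) * (t - s)))) ∧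
      (∀ x y₁ y₂ : M,
        hflow.heatKernelFn hh hR t x (y₁, s) * hflow.heatKernelFn hh hR t x (y₂, s) ≤
          Z * (t - s) ^ (-(m : ℝ)) *
            Real.exp (-2 * pointedNashEntropy h (fun r v ↦ hflow.heatKernelFn hh hR t x (v, r)) m t s) *
            Real.exp (-((h s).edist (hR s) y₁ y₂).toReal ^ 2 / ((8 + ε) * (t - s)))) := by
  classical
  /- ── universal constants ── -/
  set Hm : ℝ := ((m : ℝ) - 1) * Real.pi ^ 2 / 2 + 4 with hHm
  have hm0 : 0 < m := by omega
  have hHm0 : 0 < Hm := by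
    have h1 : (1 : ℝ) ≤ m := by exact_mod_cast hm0
    have : 0 ≤ ((m : ℝ) - 1) * Real.pi ^ 2 / 2 := by
      have := Real.pi_pos; apply div_nonneg _ (by norm_num); exact mul_nonneg (by linarith) (sq_nonneg _)
    rw [hHm]; linarith
  set c₀ : ℝ := (4 * Real.pi) ^ (-(m : ℝ) / 2) *
    Real.exp (-(m : ℝ) / 2 - Real.sqrt (2 * (m : ℝ) + 4 * Λ + 2)) with hc₀
  have hc₀0 : 0 < c₀ := mul_pos (Real.rpow_pos_of_pos (by positivity) _) (Real.exp_pos _)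
  set C' : ℝ := max (Hm / 4) (4 * Hm * (8 + ε) / ((8 + ε / 2) * ε)) with hC'
  set α : ℝ := min 1 (c₀ * Real.exp (-C')) with hα
  have hα0 : 0 < α := lt_min one_pos (mul_pos hc₀0 (Real.exp_pos _))
  have hα1 : α ≤ 1 := min_le_left _ _
  have hαc : α ≤ c₀ * Real.exp (-C') := min_le_right _ _
  obtain ⟨Zbar, hZbar, HGL⟩ := gaussianLemma_alpha m hm hΛ hε hQ hα0
  refine ⟨Zbar, hZbar, ?_⟩
  intro M _ _ _ _ _ _ _ _ _ _ h cov a T hflow hh hR s t has hst htT Rmin hRmin hRΛ Z hZ HYP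
  have hprod := HGL hflow hh hR has hst htT hRmin hRΛ hZ HYP
  have hZpos : 0 < Z := hZbar.trans_le hZ
  set τ : ℝ := t - s with hτdef
  have hτ : 0 < τ := sub_pos.2 hst
  have ht : t ∈ Ioc a T := ⟨has.trans hst, htT.le⟩
  have h8 : 0 < 8 + ε / 2 := by linarith
  have h8' : 0 < 8 + ε := by linarith
  refine ⟨fun x y z hz ↦ ?_, fun x y₁ y₂ ↦ ?_⟩
  · /- ── (7.15) ── -/
    set N : ℝ := pointedNashEntropy h (fun r v ↦ hflow.heatKernelFn hh hR t x (v, r)) m t s with hN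
    have hτpow : 0 < τ ^ (-(m : ℝ) / 2) := Real.rpow_pos_of_pos hτ _
    set P : ℝ := τ ^ (-(m : ℝ) / 2) * Real.exp (-N) with hP
    have hP0 : 0 < P := mul_pos hτpow (Real.exp_pos _)
    -- the point `y₂` near the `H_m`-centre with `K(x,t;y₂,s) ≥ c₀ P`
    obtain ⟨y₂, hy₂d, hy₂K⟩ := exists_near_hCenter_le_heatKernelFn hflow hh hR hm has hst htT.le
      (fun w ↦ hRmin s ⟨le_rfl, hst.le⟩ w) hΛ hRΛ x z hz
    set a₁ : ℝ := hflow.heatKernelFn hh hR t x (y, s) with ha₁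
    set a₂ : ℝ := hflow.heatKernelFn hh hR t x (y₂, s) with ha₂
    have ha₁pos : 0 < a₁ := hflow.heatKernelFn_pos hh hR ht x ⟨mem_univ _, has, hst⟩
    have hL : c₀ * P ≤ a₂ := by
      refine le_trans (le_of_eq ?_) hy₂K
      rw [hc₀, hP, hτdef, Real.mul_rpow (by positivity) (sub_pos.2 hst).le,
        show -N - (m : ℝ) / 2 - Real.sqrt (2 * (m : ℝ) + 4 * Λ + 2) =
          (-(m : ℝ) / 2 - Real.sqrt (2 * (m : ℝ) + 4 * Λ + 2)) + -N by ring, Real.exp_add]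
      ring
    -- the product bound at `(y, y₂)`
    set w : ℝ := ((h s).edist (hR s) y y₂).toReal with hw
    set G : ℝ := Real.exp (-w ^ 2 / ((8 + ε / 2) * τ)) with hG
    have hG0 : 0 < G := Real.exp_pos _
    have hprod' : a₁ * a₂ ≤ α * Z * P ^ 2 * G := by
      have e : α * Z * τ ^ (-(m : ℝ)) * Real.exp (-2 * N) * G = α * Z * P ^ 2 * G := by
        have e1 : τ ^ (-(m : ℝ)) = (τ ^ (-(m : ℝ) / 2)) ^ 2 := by
          rw [← Real.rpow_natCast (τ ^ (-(m : ℝ) / 2)) 2, ← Real.rpow_mul hτ.le]; norm_num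
        have e2 : Real.exp (-2 * N) = Real.exp (-N) ^ 2 := by
          rw [sq, ← Real.exp_add]; ring_nf
        rw [hP, e1, e2]; ring
      rw [← e]
      exact hprod x y y₂
    -- divide by `c₀ P`
    have ha₁le : a₁ ≤ α / c₀ * Z * P * G := by
      have h1 : a₁ * (c₀ * P) ≤ (α / c₀ * Z * P * G) * (c₀ * P) := by
        calc a₁ * (c₀ * P) ≤ a₁ * a₂ := mul_le_mul_of_nonneg_left hL ha₁pos.le
          _ ≤ α * Z * P ^ 2 * G := hprod'
          _ = (α / c₀ * Z * P * G) * (c₀ * P) := by field_simp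
      exact le_of_mul_le_mul_right h1 (mul_pos hc₀0 hP0)
    -- the shift `d_s(z,y) ≤ √(2 H_m τ) + d_s(y,y₂)`
    set u : ℝ := ((h s).edist (hR s) z y).toReal with hu
    have hu0 : 0 ≤ u := ENNReal.toReal_nonneg
    set A : ℝ := Real.sqrt (2 * (Hm * τ)) with hA
    have hA2 : A ^ 2 = 2 * Hm * τ := by
      rw [hA, Real.sq_sqrt (mul_nonneg zero_le_two (mul_pos hHm0 hτ).le)]; ring
    have huAw : u ≤ A + w := by
      have hzy₂ : ((h s).edist (hR s) z y₂).toReal < A := by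
        have := ENNReal.toReal_lt_of_lt_ofReal hy₂d
        simpa [hA, hHm, hτdef] using this
      have htri : (h s).edist (hR s) z y ≤ (h s).edist (hR s) z y₂ + (h s).edist (hR s) y₂ y :=
        PseudoRiemannianMetric.edist_triangle (hR s) z y₂ y
      have hfin1 : (h s).edist (hR s) z y₂ ≠ ⊤ := PseudoRiemannianMetric.edist_ne_top (hR s) _ _
      have hfin2 : (h s).edist (hR s) y₂ y ≠ ⊤ := PseudoRiemannianMetric.edist_ne_top (hR s) _ _
      have h1 : u ≤ ((h s).edist (hR s) z y₂).toReal + ((h s).edist (hR s) y₂ y).toReal := by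
        rw [hu, ← ENNReal.toReal_add hfin1 hfin2]
        exact ENNReal.toReal_mono (ENNReal.add_ne_top.2 ⟨hfin1, hfin2⟩) htri
      have h2 : ((h s).edist (hR s) y₂ y).toReal = w := by
        rw [hw, PseudoRiemannianMetric.edist_comm]
      linarith
    have hshift : G ≤ Real.exp C' * Real.exp (-u ^ 2 / ((8 + ε) * τ)) :=
      exp_neg_sq_div_le_exp_mul_exp_neg_sq_div hε hτ hu0 hA2 huAw
    -- assemble
    have hcoef : α / c₀ * Real.exp C' ≤ 1 := by
      rw [div_mul_eq_mul_div, div_le_one hc₀0]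
      calc α * Real.exp C' ≤ c₀ * Real.exp (-C') * Real.exp C' :=
            mul_le_mul_of_nonneg_right hαc (Real.exp_pos _).le
        _ = c₀ := by rw [mul_assoc, ← Real.exp_add, neg_add_cancel, Real.exp_zero, mul_one]
    calc a₁ ≤ α / c₀ * Z * P * G := ha₁le
      _ ≤ α / c₀ * Z * P * (Real.exp C' * Real.exp (-u ^ 2 / ((8 + ε) * τ))) :=
          mul_le_mul_of_nonneg_left hshift (by positivity)
      _ = (α / c₀ * Real.exp C') * (Z * P * Real.exp (-u ^ 2 / ((8 + ε) * τ))) := by ring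
      _ ≤ 1 * (Z * P * Real.exp (-u ^ 2 / ((8 + ε) * τ))) :=
          mul_le_mul_of_nonneg_right hcoef (by positivity)
      _ = Z * (t - s) ^ (-(m : ℝ) / 2) * Real.exp (-N) *
            Real.exp (-u ^ 2 / ((8 + ε) * (t - s))) := by rw [hP, hτdef]; ring
  · /- ── (7.16) ── -/
    have h1 := hprod x y₁ y₂
    set N : ℝ := pointedNashEntropy h (fun r v ↦ hflow.heatKernelFn hh hR t x (v, r)) m t s with hN
    set d : ℝ := ((h s).edist (hR s) y₁ y₂).toReal with hd
    have hmono : Real.exp (-d ^ 2 / ((8 + ε / 2) * (t - s))) ≤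
        Real.exp (-d ^ 2 / ((8 + ε) * (t - s))) := by
      rw [Real.exp_le_exp, neg_div, neg_div, neg_le_neg_iff]
      exact div_le_div_of_nonneg_left (sq_nonneg _) (mul_pos h8 hτ)
        (mul_le_mul_of_nonneg_right (by linarith) hτ.le)
    have hfac : 0 ≤ (t - s) ^ (-(m : ℝ)) * Real.exp (-2 * N) :=
      mul_nonneg (Real.rpow_nonneg hτ.le _) (Real.exp_pos _).le
    calc hflow.heatKernelFn hh hR t x (y₁, s) * hflow.heatKernelFn hh hR t x (y₂, s)
        ≤ α * Z * (t - s) ^ (-(m : ℝ)) * Real.exp (-2 * N) *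
            Real.exp (-d ^ 2 / ((8 + ε / 2) * (t - s))) := h1
      _ = α * (Z * ((t - s) ^ (-(m : ℝ)) * Real.exp (-2 * N)) *
            Real.exp (-d ^ 2 / ((8 + ε / 2) * (t - s)))) := by ring
      _ ≤ 1 * (Z * ((t - s) ^ (-(m : ℝ)) * Real.exp (-2 * N)) *
            Real.exp (-d ^ 2 / ((8 + ε) * (t - s)))) := by
          refine mul_le_mul hα1 (mul_le_mul_of_nonneg_left hmono (mul_nonneg hZpos.le hfac))
            (by positivity) zero_le_one
      _ = Z * (t - s) ^ (-(m : ℝ)) * Real.exp (-2 * N) *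
            Real.exp (-d ^ 2 / ((8 + ε) * (t - s))) := by ring

end Kernel

end Literature.Geometry.Riemannian

end
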